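import Summits.Ventures.Crystal3D.Bulk.GapRhombusBounds
import Summits.Ventures.Crystal3D.Bulk.GapCornerEnvelopes
import HarnessLib

/-!
# The `60°`-rhombus corner CURVE beyond its polygon `K4`: the tangent cut `3u + 2v ≤ 8τ` and the
# interior maximum of `u + ¾v` (kernel real analysis; used for the 36 curve rows of `P4.txt`)

HONEST FRAMING. Part of the venture `Summits/Ventures/Crystal3D` (cell `pub-crystal3d`, phase 2;
seat p2, PROMOTION-AUDIT record, memo r1.1 item A6 (b1) / A7 items 4·11, DECISION-GAP-2 §3 (P6)).
Kernel theorems about an ADMISSIBLE fourteen-ball configuration `c` (`IsGapConfig c`, no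
extremality, no orientation or face hypothesis) and elementary real analysis; nothing here asserts
anything about GAP(1.26); no census number, head, class or grade word moves.

The adjacent corners `u, v` of a tight shell rhombus satisfy the exact relation
`(1 − cos u)(1 − cos v) = 4(1 + cos u)(1 + cos v)` (`IsGapConfig.rhombus_corner_relation`), i.e.
`tan (u/2) tan (v/2) = 2` (`cos_half_add_half_of_rhombusRel`, `Bulk/GapRhombusBounds.lean`), with
`u, v ∈ [τ, 2τ]`, `τ = arccos (1/3)`. The kernel polygon `K4` of those bounds (and
`3τ ≤ u + v ≤ 2π − 2τ`) implies 94 of the 130 rows of the B-lineage polytope table `P4.txt`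
(`Bulk/GapRhombusP4Rows.lean`); the other 36 need the CURVE. With `a = tan (u/2) ∈ (0, 2√2]`,
`u = 2 arctan a`, `v = 2 arctan (2/a)`, this file proves:
* **`rhombusRel_three_two_le`**: the TANGENT CUT `3u + 2v ≤ 8τ` at the end point `(2τ, τ)` —
  `ψ(a) = 3 arctan a + 2 arctan (2/a)` has `ψ' = (8 − a²)/((1 + a²)(4 + a²)) ≥ 0` on `(0, 2√2]`
  (`monotoneOn_rhombusPsi`), so `ψ ≤ ψ(2√2) = 3τ + 2(τ/2)` by `tan τ = 2√2` (`tan_arccos_third`) and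
  `tan (τ/2) = 1/√2` (`tan_half_arccos_third`, from the half-angle law at `(2τ, τ)`);
* **`rhombusRel_one_three_quarters_le`**: `u + ¾v ≤ 3.395745` — `φ(a) = arctan a + ¾ arctan (2/a)`
  has `φ' = (5 − a²)/(2(1 + a²)(4 + a²))`, increases on `(0, √5]`, decreases on `[√5, ∞)`
  (`monotoneOn_rhombusPhi`, `antitoneOn_rhombusPhi`), so `u + ¾v = 2φ(a) ≤ 2φ(√5) =
  2 arctan √5 + (3/2) arctan (2/√5) = 3.3951155…`, bounded in the kernel by `arctan √5 < 1.15041`,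
  `arctan (2/√5) < 0.72995` (`arctan x = arccos (1/√(1 + x²))` and the tree's Taylor bracket
  `abs_cos_sub_taylor_le`, `Bulk/GapCornerEnvelopes.lean`); the maximum is INTERIOR
  (`u = 131.81°`, `v = 83.62°`), which is why no polygon of end-point rows can give it;
* §2: the same for the adjacent corners of every tight shell rhombus of an admissible `c` with
  `intruderDist c < 2`, both orientations: **`IsGapConfig.rhombus_tangent_cut`**,
  **`IsGapConfig.rhombus_three_quarters`**.
The cut and the `¾`-maximum are elementary calculus on the printed relation (FTTT13 Lemma 6 /
MT12 Prop. 3.8 give the relation, not these consequences); they replace polylib's interval grid for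
the rhombus faces. References: Flatley–Tarasov–Taylor–Theil 2013, Lemma 6 [`FlatleyEtAl2013`];
Musin–Tarasov 2012, Prop. 3.8 [`MusinTarasov2012`].
-/

noncomputable section

open scoped BigOperators InnerProductSpace
open Finset Real

namespace Summit.Ventures.Crystal3D

/-! ## §1 Real analysis on the rhombus curve -/

section CurveReal

open Literature.Geometry.DiscreteGeometry

/-- `tan (arccos (1/3)) = 2√2`. [folklore] -/
theorem tan_arccos_third : tan (arccos (1 / 3)) = 2 * √2 := by
  rw [tan_eq_sin_div_cos, sin_arccos, cos_arccos (by norm_num) (by norm_num)]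
  have h : √(1 - (1 / 3 : ℝ) ^ 2) = 2 * √2 / 3 := by
    have h2 : (2 * √2 / 3 : ℝ) ^ 2 = 1 - (1 / 3) ^ 2 := by
      rw [div_pow, mul_pow, sq_sqrt (by norm_num : (0:ℝ) ≤ 2)]; norm_num
    rw [← h2]
    exact sqrt_sq (by positivity)
  rw [h]; ring

/-- `arctan (2√2) = arccos (1/3)`. [folklore] -/
theorem arctan_two_sqrt_two : arctan (2 * √2) = arccos (1 / 3) := by
  rw [← tan_arccos_third]
  exact arctan_tan (by linarith [arccos_nonneg (1 / 3 : ℝ), pi_pos])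
    (arccos_lt_pi_div_two.2 (by norm_num))

/-- `tan (arccos (1/3) / 2) = 2 (2√2)⁻¹` (`= 1/√2`; from the half-angle law of the `60°`-rhombus at
its degenerate end `(u, v) = (2τ, τ)`). [folklore] -/
theorem tan_half_arccos_third : tan (arccos (1 / 3) / 2) = 2 * (2 * √2)⁻¹ := by
  have h0 := arccos_nonneg (1 / 3 : ℝ)
  have hπ := arccos_le_pi (1 / 3 : ℝ)
  have hlt := arccos_third_lt
  have hc1 : cos (arccos (1 / 3)) = 1 / 3 := cos_arccos (by norm_num) (by norm_num)
  have hc2 : cos (2 * arccos (1 / 3)) = -7 / 9 := cos_two_mul_arccos_third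
  have hrel : (1 - cos (2 * arccos (1 / 3))) * (1 - cos (arccos (1 / 3))) =
      4 * ((1 + cos (2 * arccos (1 / 3))) * (1 + cos (arccos (1 / 3)))) := by
    rw [hc1, hc2]; norm_num
  have h := (cos_half_add_half_of_rhombusRel (u := 2 * arccos (1 / 3)) (v := arccos (1 / 3))
    (by linarith) (by linarith [pi_gt_three]) h0 hπ hrel).1
  rw [show 2 * arccos (1 / 3) / 2 = arccos (1 / 3) by ring] at h
  -- h : sin τ * sin (τ/2) = 2 * (cos τ * cos (τ/2))
  have hcpos : 0 < cos (arccos (1 / 3) / 2) :=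
    cos_pos_of_mem_Ioo ⟨by linarith [pi_pos], by linarith [pi_gt_three]⟩
  have hspos : 0 < sin (arccos (1 / 3)) := by
    rw [sin_arccos]; positivity
  have ht : tan (arccos (1 / 3)) = 2 * √2 := tan_arccos_third
  rw [tan_eq_sin_div_cos] at ht ⊢
  rw [hc1] at ht h
  have hs : sin (arccos (1 / 3)) = 2 * √2 / 3 := by
    field_simp at ht; linarith
  rw [hs] at h
  have h2 : (0:ℝ) < √2 := by positivity
  field_simp
  nlinarith [h, hcpos, h2]

/-- `arctan (2 (2√2)⁻¹) = arccos (1/3) / 2`. [folklore] -/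
theorem arctan_two_mul_inv_two_sqrt_two : arctan (2 * (2 * √2)⁻¹) = arccos (1 / 3) / 2 := by
  rw [← tan_half_arccos_third]
  exact arctan_tan (by linarith [arccos_nonneg (1 / 3 : ℝ), pi_pos])
    (by linarith [arccos_lt_pi_div_two.2 (show (0:ℝ) < 1 / 3 by norm_num), pi_pos])

/-- Derivative of `ψ(a) = 3 arctan a + 2 arctan (2/a)` at `a ≠ 0`. -/
theorem hasDerivAt_rhombusPsi {a : ℝ} (ha : a ≠ 0) :
    HasDerivAt (fun t : ℝ => 3 * arctan t + 2 * arctan (2 * t⁻¹))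
      (3 * (1 / (1 + a ^ 2)) + 2 * (1 / (1 + (2 * a⁻¹) ^ 2) * (2 * -(a ^ 2)⁻¹))) a := by
  have h1 : HasDerivAt (fun t : ℝ => 3 * arctan t) (3 * (1 / (1 + a ^ 2))) a :=
    (Real.hasDerivAt_arctan a).const_mul 3
  have h2 : HasDerivAt (fun t : ℝ => 2 * t⁻¹) (2 * -(a ^ 2)⁻¹) a := (hasDerivAt_inv ha).const_mul 2
  have h3' := (Real.hasDerivAt_arctan (2 * a⁻¹)).comp a h2
  have h3 : HasDerivAt (fun t : ℝ => arctan (2 * t⁻¹))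
      (1 / (1 + (2 * a⁻¹) ^ 2) * (2 * -(a ^ 2)⁻¹)) a := h3'
  exact h1.add (h3.const_mul 2)

/-- `ψ(a) = 3 arctan a + 2 arctan (2/a)` is monotone on `(0, 2√2]` (`ψ' = (8 − a²)/((1+a²)(4+a²))`). -/
theorem monotoneOn_rhombusPsi :
    MonotoneOn (fun t : ℝ => 3 * arctan t + 2 * arctan (2 * t⁻¹)) (Set.Ioc 0 (2 * √2)) := by
  apply monotoneOn_of_deriv_nonneg (convex_Ioc 0 (2 * √2))
  · exact fun x hx => (hasDerivAt_rhombusPsi (ne_of_gt hx.1)).continuousAt.continuousWithinAt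
  · intro x hx
    rw [interior_Ioc] at hx
    exact (hasDerivAt_rhombusPsi (ne_of_gt hx.1)).differentiableAt.differentiableWithinAt
  · intro x hx
    rw [interior_Ioc] at hx
    have hx0 : 0 < x := hx.1
    have hx8 : x ^ 2 < 8 := by
      have h := hx.2
      have h2 : (2 * √2) ^ 2 = 8 := by rw [mul_pow, sq_sqrt (by norm_num : (0:ℝ) ≤ 2)]; norm_num
      nlinarith [sqrt_nonneg (2:ℝ)]
    rw [(hasDerivAt_rhombusPsi (ne_of_gt hx0)).deriv]
    have hx' : x ≠ 0 := ne_of_gt hx0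
    rw [show 3 * (1 / (1 + x ^ 2)) + 2 * (1 / (1 + (2 * x⁻¹) ^ 2) * (2 * -(x ^ 2)⁻¹)) =
        (8 - x ^ 2) / ((1 + x ^ 2) * (x ^ 2 + 4)) by field_simp; ring]
    exact div_nonneg (by linarith) (by positivity)

/-- **Tangent cut of the rhombus curve at its end point `(2τ, τ)`**: for `u, v ∈ [0, π]` with the
`60°`-rhombus relation and `cos u, cos v ≤ 1/3`: `3u + 2v ≤ 8 arccos (1/3)`. (The curve
`cot (u/2) cot (v/2) = 1/2` is concave and has slope `−3/2` at `(2τ, τ)`; the proof is the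
monotonicity of `3 arctan a + 2 arctan (2/a)` in `a = tan (u/2) ≤ tan τ = 2√2`.) [folklore] -/
theorem rhombusRel_three_two_le {u v : ℝ} (hu0 : 0 ≤ u) (huπ : u ≤ π) (hv0 : 0 ≤ v) (hvπ : v ≤ π)
    (hrel : (1 - cos u) * (1 - cos v) = 4 * ((1 + cos u) * (1 + cos v)))
    (hcu : cos u ≤ 1 / 3) (hcv : cos v ≤ 1 / 3) :
    3 * u + 2 * v ≤ 8 * arccos (1 / 3) := by
  have hτlt := arccos_third_lt
  have hτgt := lt_arccos_third
  have hτ2 : arccos (1 / 3) < π / 2 := arccos_lt_pi_div_two.2 (by norm_num)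
  have hrel' : (1 - cos v) * (1 - cos u) = 4 * ((1 + cos v) * (1 + cos u)) := by linarith [hrel]
  have hu2 : u ≤ 2 * arccos (1 / 3) := rhombusRel_le_two_mul_arccos_third hu0 huπ hrel hcv
  have hv2 : v ≤ 2 * arccos (1 / 3) := rhombusRel_le_two_mul_arccos_third hv0 hvπ hrel' hcu
  have hu1 : arccos (1 / 3) ≤ u := by rw [← arccos_cos hu0 huπ]; exact arccos_le_arccos hcu
  have hv1 : arccos (1 / 3) ≤ v := by rw [← arccos_cos hv0 hvπ]; exact arccos_le_arccos hcv
  have hprod := (cos_half_add_half_of_rhombusRel hu0 huπ hv0 hvπ hrel).1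
  have hcx : 0 < cos (u / 2) := cos_pos_of_mem_Ioo ⟨by linarith, by linarith⟩
  have hcy : 0 < cos (v / 2) := cos_pos_of_mem_Ioo ⟨by linarith, by linarith⟩
  have hsx : 0 < sin (u / 2) := sin_pos_of_pos_of_lt_pi (by linarith) (by linarith)
  have ha : 0 < tan (u / 2) := by rw [tan_eq_sin_div_cos]; positivity
  have hty : tan (v / 2) = 2 * (tan (u / 2))⁻¹ := by
    rw [tan_eq_sin_div_cos, tan_eq_sin_div_cos]
    field_simp
    linarith [hprod]
  have hx : u / 2 = arctan (tan (u / 2)) := (arctan_tan (by linarith) (by linarith)).symm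
  have hy : v / 2 = arctan (2 * (tan (u / 2))⁻¹) := by
    rw [← hty]; exact (arctan_tan (by linarith) (by linarith)).symm
  have hale : tan (u / 2) ≤ 2 * √2 := by
    rw [← arctan_le_arctan_iff, ← hx, arctan_two_sqrt_two]; linarith
  have hmono := monotoneOn_rhombusPsi ⟨ha, hale⟩ ⟨by positivity, le_refl _⟩ hale
  simp only at hmono
  rw [arctan_two_sqrt_two, arctan_two_mul_inv_two_sqrt_two, ← hx, ← hy] at hmono
  linarith

/-- Derivative of `φ(a) = arctan a + (3/4) arctan (2/a)` at `a ≠ 0`. -/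
theorem hasDerivAt_rhombusPhi {a : ℝ} (ha : a ≠ 0) :
    HasDerivAt (fun t : ℝ => arctan t + 3 / 4 * arctan (2 * t⁻¹))
      (1 / (1 + a ^ 2) + 3 / 4 * (1 / (1 + (2 * a⁻¹) ^ 2) * (2 * -(a ^ 2)⁻¹))) a := by
  have h2 : HasDerivAt (fun t : ℝ => 2 * t⁻¹) (2 * -(a ^ 2)⁻¹) a := (hasDerivAt_inv ha).const_mul 2
  have h3' := (Real.hasDerivAt_arctan (2 * a⁻¹)).comp a h2
  have h3 : HasDerivAt (fun t : ℝ => arctan (2 * t⁻¹))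
      (1 / (1 + (2 * a⁻¹) ^ 2) * (2 * -(a ^ 2)⁻¹)) a := h3'
  exact (Real.hasDerivAt_arctan a).add (h3.const_mul (3 / 4))

/-- The derivative of `φ` in closed form: `(5 − a²) / (2 (1 + a²)(a² + 4))`. -/
theorem deriv_rhombusPhi_eq {a : ℝ} (ha : a ≠ 0) :
    1 / (1 + a ^ 2) + 3 / 4 * (1 / (1 + (2 * a⁻¹) ^ 2) * (2 * -(a ^ 2)⁻¹)) =
      (5 - a ^ 2) / (2 * ((1 + a ^ 2) * (a ^ 2 + 4))) := by
  field_simp; ring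

/-- `φ(a) = arctan a + (3/4) arctan (2/a)` is monotone on `(0, √5]`. -/
theorem monotoneOn_rhombusPhi :
    MonotoneOn (fun t : ℝ => arctan t + 3 / 4 * arctan (2 * t⁻¹)) (Set.Ioc 0 (√5)) := by
  apply monotoneOn_of_deriv_nonneg (convex_Ioc 0 (√5))
  · exact fun x hx => (hasDerivAt_rhombusPhi (ne_of_gt hx.1)).continuousAt.continuousWithinAt
  · intro x hx
    rw [interior_Ioc] at hx
    exact (hasDerivAt_rhombusPhi (ne_of_gt hx.1)).differentiableAt.differentiableWithinAt
  · intro x hx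
    rw [interior_Ioc] at hx
    have hx0 : 0 < x := hx.1
    have hx5 : x ^ 2 ≤ 5 := by
      have h2 : (√5 : ℝ) ^ 2 = 5 := sq_sqrt (by norm_num)
      nlinarith [sqrt_nonneg (5:ℝ), hx.2]
    rw [(hasDerivAt_rhombusPhi (ne_of_gt hx0)).deriv, deriv_rhombusPhi_eq (ne_of_gt hx0)]
    exact div_nonneg (by linarith) (by positivity)

/-- `φ(a) = arctan a + (3/4) arctan (2/a)` is antitone on `[√5, ∞)`. -/
theorem antitoneOn_rhombusPhi :
    AntitoneOn (fun t : ℝ => arctan t + 3 / 4 * arctan (2 * t⁻¹)) (Set.Ici (√5)) := by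
  have h5 : (0:ℝ) < √5 := by positivity
  apply antitoneOn_of_deriv_nonpos (convex_Ici (√5))
  · exact fun x hx => (hasDerivAt_rhombusPhi (ne_of_gt (lt_of_lt_of_le h5 hx))).continuousAt.continuousWithinAt
  · intro x hx
    rw [interior_Ici] at hx
    exact (hasDerivAt_rhombusPhi (ne_of_gt (h5.trans hx))).differentiableAt.differentiableWithinAt
  · intro x hx
    rw [interior_Ici] at hx
    have hx0 : 0 < x := h5.trans hx
    have hx5 : 5 ≤ x ^ 2 := by
      have h2 : (√5 : ℝ) ^ 2 = 5 := sq_sqrt (by norm_num)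
      have := pow_le_pow_left₀ (sqrt_nonneg 5) (le_of_lt hx) 2
      rw [h2] at this; exact this
    rw [(hasDerivAt_rhombusPhi (ne_of_gt hx0)).deriv, deriv_rhombusPhi_eq (ne_of_gt hx0)]
    exact div_nonpos_of_nonpos_of_nonneg (by linarith) (by positivity)

/-- `φ(a) ≤ φ(√5)` for every `a > 0`. -/
theorem rhombusPhi_le {a : ℝ} (ha : 0 < a) :
    arctan a + 3 / 4 * arctan (2 * a⁻¹) ≤ arctan (√5) + 3 / 4 * arctan (2 * (√5)⁻¹) := by
  have h5 : (0:ℝ) < √5 := by positivity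
  rcases le_total a (√5) with h | h
  · have := monotoneOn_rhombusPhi ⟨ha, h⟩ ⟨h5, le_refl _⟩ h
    simpa using this
  · have := antitoneOn_rhombusPhi (Set.self_mem_Ici) (h : √5 ≤ a) h
    simpa using this

/-- `arctan √5 < 1.15041` (`arctan √5 = arccos (1/√6) = 1.1502619…`). [folklore] -/
theorem arctan_sqrt_five_lt : arctan (√5) < 1.15041 := by
  rw [arctan_eq_arccos (by positivity)]
  have h6 : √(1 + (√5 : ℝ) ^ 2) = √6 := by rw [sq_sqrt (by norm_num : (0:ℝ) ≤ 5)]; norm_num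
  rw [h6]
  apply arccos_lt_of_cos_lt (by norm_num) (by linarith [pi_gt_three])
    (by rw [inv_le_one_iff₀]; right; rw [le_sqrt (by norm_num) (by norm_num)]; norm_num)
  -- cos 1.15041 < 0.40824 < (√6)⁻¹
  have hs : √6 < 2.4495 := by rw [sqrt_lt' (by norm_num)]; norm_num
  have hs0 : 0 < √6 := by positivity
  have hinv : (0.40824 : ℝ) < (√6)⁻¹ := by
    rw [lt_inv_comm₀ (by norm_num) hs0]; linarith
  refine lt_trans ?_ hinv
  have h := abs_cos_sub_taylor_le (1.15041 : ℝ) 8 (by rw [abs_of_pos (by norm_num)]; norm_num)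
  rw [abs_of_pos (show (0:ℝ) < 1.15041 by norm_num)] at h
  have h' := (abs_sub_le_iff.1 h).1
  simp only [sum_range_succ, sum_range_zero] at h'
  norm_num [Nat.factorial] at h'
  linarith

/-- `arctan (2/√5) < 0.72995` (`arctan (2/√5) = arccos (√5/3) = 0.7297276…`). [folklore] -/
theorem arctan_two_div_sqrt_five_lt : arctan (2 * (√5)⁻¹) < 0.72995 := by
  rw [arctan_eq_arccos (by positivity)]
  have h5 : (√5 : ℝ) ^ 2 = 5 := sq_sqrt (by norm_num)
  have h95 : √(1 + (2 * (√5)⁻¹ : ℝ) ^ 2) = √(9 / 5) := by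
    congr 1; field_simp; rw [h5]; norm_num
  rw [h95]
  apply arccos_lt_of_cos_lt (by norm_num) (by linarith [pi_gt_three])
    (by rw [inv_le_one_iff₀]; right; rw [le_sqrt (by norm_num) (by norm_num)]; norm_num)
  have hs : √(9 / 5 : ℝ) < 1.3417 := by rw [sqrt_lt' (by norm_num)]; norm_num
  have hs0 : 0 < √(9 / 5 : ℝ) := by positivity
  have hinv : (0.7453 : ℝ) < (√(9 / 5 : ℝ))⁻¹ := by
    rw [lt_inv_comm₀ (by norm_num) hs0]; linarith
  refine lt_trans ?_ hinv
  have h := abs_cos_sub_taylor_le (0.72995 : ℝ) 8 (by rw [abs_of_pos (by norm_num)]; norm_num)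
  rw [abs_of_pos (show (0:ℝ) < 0.72995 by norm_num)] at h
  have h' := (abs_sub_le_iff.1 h).1
  simp only [sum_range_succ, sum_range_zero] at h'
  norm_num [Nat.factorial] at h'
  linarith

/-- **The `¾`-row of the rhombus curve**: for `u, v ∈ [0, π]` with the `60°`-rhombus relation and
`cos u, cos v ≤ 1/3`: `u + (3/4) v ≤ 3.395745` (the maximum `2 arctan √5 + (3/2) arctan (2/√5) =
3.3951155…` is interior, at `tan (u/2) = √5`, i.e. `u = 131.81°`, `v = 83.62°`). [folklore] -/
theorem rhombusRel_one_three_quarters_le {u v : ℝ} (hu0 : 0 ≤ u) (huπ : u ≤ π) (hv0 : 0 ≤ v)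
    (hvπ : v ≤ π) (hrel : (1 - cos u) * (1 - cos v) = 4 * ((1 + cos u) * (1 + cos v)))
    (hcu : cos u ≤ 1 / 3) (hcv : cos v ≤ 1 / 3) :
    u + 3 / 4 * v ≤ 3.395745 := by
  have hτlt := arccos_third_lt
  have hτgt := lt_arccos_third
  have hτ2 : arccos (1 / 3) < π / 2 := arccos_lt_pi_div_two.2 (by norm_num)
  have hrel' : (1 - cos v) * (1 - cos u) = 4 * ((1 + cos v) * (1 + cos u)) := by linarith [hrel]
  have hu2 : u ≤ 2 * arccos (1 / 3) := rhombusRel_le_two_mul_arccos_third hu0 huπ hrel hcv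
  have hv2 : v ≤ 2 * arccos (1 / 3) := rhombusRel_le_two_mul_arccos_third hv0 hvπ hrel' hcu
  have hu1 : arccos (1 / 3) ≤ u := by rw [← arccos_cos hu0 huπ]; exact arccos_le_arccos hcu
  have hv1 : arccos (1 / 3) ≤ v := by rw [← arccos_cos hv0 hvπ]; exact arccos_le_arccos hcv
  have hprod := (cos_half_add_half_of_rhombusRel hu0 huπ hv0 hvπ hrel).1
  have hcx : 0 < cos (u / 2) := cos_pos_of_mem_Ioo ⟨by linarith, by linarith⟩
  have hcy : 0 < cos (v / 2) := cos_pos_of_mem_Ioo ⟨by linarith, by linarith⟩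
  have hsx : 0 < sin (u / 2) := sin_pos_of_pos_of_lt_pi (by linarith) (by linarith)
  have ha : 0 < tan (u / 2) := by rw [tan_eq_sin_div_cos]; positivity
  have hty : tan (v / 2) = 2 * (tan (u / 2))⁻¹ := by
    rw [tan_eq_sin_div_cos, tan_eq_sin_div_cos]
    field_simp
    linarith [hprod]
  have hx : u / 2 = arctan (tan (u / 2)) := (arctan_tan (by linarith) (by linarith)).symm
  have hy : v / 2 = arctan (2 * (tan (u / 2))⁻¹) := by
    rw [← hty]; exact (arctan_tan (by linarith) (by linarith)).symm
  have hle := rhombusPhi_le ha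
  rw [← hx, ← hy] at hle
  have h1 := arctan_sqrt_five_lt
  have h2 := arctan_two_div_sqrt_five_lt
  linarith

end CurveReal

/-! ## §2 The cut and the `¾`-bound at a tight shell rhombus -/

section ConfigCurve

open Literature.Geometry.DiscreteGeometry InnerProductGeometry

variable {c : Fin 14 → EuclideanSpace ℝ (Fin 3)}

/-- **Tangent cut for a tight shell rhombus**: for an admissible configuration with
`intruderDist c < 2` and shell balls `a, b, e, d` with contacts `ab, be, ed, da`, `a ≠ e`, `b ≠ d`,
the adjacent corners `u_a = corner c a b d`, `u_b = corner c b a e` satisfy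
`3u_a + 2u_b ≤ 8 arccos (1/3)` and `3u_b + 2u_a ≤ 8 arccos (1/3)`. [folklore] -/
theorem IsGapConfig.rhombus_tangent_cut (hc : IsGapConfig c) (hD : intruderDist c < 2)
    {a b e d : Fin 14} (ha0 : a ≠ 0) (ha13 : a ≠ 13) (hb0 : b ≠ 0) (hb13 : b ≠ 13)
    (he0 : e ≠ 0) (he13 : e ≠ 13) (hd0 : d ≠ 0) (hd13 : d ≠ 13) (hae : a ≠ e) (hbd : b ≠ d)
    (hab : dist (c a) (c b) = 1) (hbe : dist (c b) (c e) = 1) (hed : dist (c e) (c d) = 1)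
    (hda : dist (c d) (c a) = 1) :
    3 * corner c a b d + 2 * corner c b a e ≤ 8 * Real.arccos (1 / 3) ∧
      3 * corner c b a e + 2 * corner c a b d ≤ 8 * Real.arccos (1 / 3) := by
  have hba : dist (c b) (c a) = 1 := by rw [dist_comm]; exact hab
  have had : dist (c a) (c d) = 1 := by rw [dist_comm]; exact hda
  have heb : dist (c e) (c b) = 1 := by rw [dist_comm]; exact hbe
  have hde : dist (c d) (c e) = 1 := by rw [dist_comm]; exact hed
  have hrel := hc.rhombus_corner_relation hD ha0 ha13 hb0 hb13 he0 he13 hd0 hd13 hae hbd hab hbe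
    hed hda
  have hrel' := hc.rhombus_corner_relation hD hb0 hb13 ha0 ha13 hd0 hd13 he0 he13 hbd hae hba had
    hde heb
  have hcu := hc.cos_corner_le_third ha0 ha13 hb0 hb13 hd0 hd13 hab had hbd
  have hcv := hc.cos_corner_le_third hb0 hb13 ha0 ha13 he0 he13 hba hbe hae
  exact ⟨rhombusRel_three_two_le (corner_nonneg c a b d) (corner_le_pi c a b d)
      (corner_nonneg c b a e) (corner_le_pi c b a e) hrel hcu hcv,
    rhombusRel_three_two_le (corner_nonneg c b a e) (corner_le_pi c b a e)
      (corner_nonneg c a b d) (corner_le_pi c a b d) hrel' hcv hcu⟩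

/-- **The `¾`-bound for a tight shell rhombus**: with the hypotheses of
`IsGapConfig.rhombus_tangent_cut`, `u_a + ¾u_b ≤ 3.395745` and `u_b + ¾u_a ≤ 3.395745`. [folklore] -/
theorem IsGapConfig.rhombus_three_quarters (hc : IsGapConfig c) (hD : intruderDist c < 2)
    {a b e d : Fin 14} (ha0 : a ≠ 0) (ha13 : a ≠ 13) (hb0 : b ≠ 0) (hb13 : b ≠ 13)
    (he0 : e ≠ 0) (he13 : e ≠ 13) (hd0 : d ≠ 0) (hd13 : d ≠ 13) (hae : a ≠ e) (hbd : b ≠ d)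
    (hab : dist (c a) (c b) = 1) (hbe : dist (c b) (c e) = 1) (hed : dist (c e) (c d) = 1)
    (hda : dist (c d) (c a) = 1) :
    corner c a b d + 3 / 4 * corner c b a e ≤ 3.395745 ∧
      corner c b a e + 3 / 4 * corner c a b d ≤ 3.395745 := by
  have hba : dist (c b) (c a) = 1 := by rw [dist_comm]; exact hab
  have had : dist (c a) (c d) = 1 := by rw [dist_comm]; exact hda
  have heb : dist (c e) (c b) = 1 := by rw [dist_comm]; exact hbe
  have hde : dist (c d) (c e) = 1 := by rw [dist_comm]; exact hed
  have hrel := hc.rhombus_corner_relation hD ha0 ha13 hb0 hb13 he0 he13 hd0 hd13 hae hbd hab hbe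
    hed hda
  have hrel' := hc.rhombus_corner_relation hD hb0 hb13 ha0 ha13 hd0 hd13 he0 he13 hbd hae hba had
    hde heb
  have hcu := hc.cos_corner_le_third ha0 ha13 hb0 hb13 hd0 hd13 hab had hbd
  have hcv := hc.cos_corner_le_third hb0 hb13 ha0 ha13 he0 he13 hba hbe hae
  exact ⟨rhombusRel_one_three_quarters_le (corner_nonneg c a b d) (corner_le_pi c a b d)
      (corner_nonneg c b a e) (corner_le_pi c b a e) hrel hcu hcv,
    rhombusRel_one_three_quarters_le (corner_nonneg c b a e) (corner_le_pi c b a e)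
      (corner_nonneg c a b d) (corner_le_pi c a b d) hrel' hcv hcu⟩

end ConfigCurve

end Summit.Ventures.Crystal3D
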